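import Summits.CriticalPhenomena.CardyFormulaZ2.Theses.CardyBoundaryCoulombGas

/-!
# Stub `stub_transfer` of line `rainbow-monomials-in-excursion-kernels` — Part 1: limit algebra
# (crux `CardyBoundaryCoulombGas.BoundaryDefectGaussianR`, stmt-CriticalPhenomena-14132)

Pure bookkeeping used by the transfer stub (Stub 6) of the line: the Kac identity
`Σ_{i' ≠ i} (−e_i e_i'/6) = h(e_i)` at `Σ e = 1`, the symmetric pair-sum rearrangement, the
cancellation of the mesh powers `Σ_i h(e_i) = 2 Σ_{i<i'} (−e_i e_i'/6)`, the abstract limit lemma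
"`F_n → ℓ`, `P_n > 0` eventually, `G_n/δ_n² → c·K > 0` ⟹ `δ_n^{-H} P_n → e^ℓ ∏ (cK)^a`", and the
rewriting of `∏_{i<i'} (c K_{ii'})^{a_{ii'}}` into the crux's product of `|w_i − w_i'|^{e_ie_i'/3}` and
`|w′_i|^{h(e_i)}`. Everything here is elementary real analysis (Mathlib `Real.rpow`, `Real.exp`,
`Real.log`, `Filter.Tendsto`).
-/

noncomputable section

open Filter Topology

namespace Summit.CriticalPhenomena.CardyFormulaZ2.Cruxes.BoundaryDefectGaussianR.RainbowMonomialsInExcursionKernels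

/-- **Kac weights from pairs.** For a label vector with `Σ_j e_j = 1`, the total exponent the pair
monomial assigns to the point `i` is `h(e_i) = e_i (e_i - 1)/6`. [folklore] -/
theorem transfer_kac {k : ℕ} (e : Fin k → ℝ) (hsum : ∑ j, e j = 1) (i : Fin k) :
    ∑ j ∈ Finset.univ.erase i, (-(e i * e j) / 6) = e i * (e i - 1) / 6 := by
  have h1 : ∑ j ∈ Finset.univ.erase i, (-(e i * e j) / 6) =
      -(e i / 6) * ∑ j ∈ Finset.univ.erase i, e j := by
    rw [Finset.mul_sum]
    refine Finset.sum_congr rfl fun j _ => ?_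
    ring
  rw [h1, Finset.sum_erase_eq_sub (Finset.mem_univ i), hsum]
  ring

/-- The punctured index set splits into the indices above and below `i`. [folklore] -/
theorem transfer_sum_erase_split {k : ℕ} (f : Fin k → ℝ) (i : Fin k) :
    ∑ i' ∈ Finset.univ.erase i, f i' =
      ∑ i' ∈ Finset.univ.filter (fun i' ↦ i < i'), f i' +
        ∑ i' ∈ Finset.univ.filter (fun i' ↦ i' < i), f i' := by
  rw [← Finset.sum_filter_add_sum_filter_not (Finset.univ.erase i) (fun i' ↦ i < i')]
  congr 1
  · refine Finset.sum_congr ?_ fun _ _ => rfl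
    ext x
    simp only [Finset.mem_filter, Finset.mem_erase, Finset.mem_univ, and_true, true_and, ne_eq,
      and_iff_right_iff_imp]
    exact fun h => h.ne'
  · refine Finset.sum_congr ?_ fun _ _ => rfl
    ext x
    simp only [Finset.mem_filter, Finset.mem_erase, Finset.mem_univ, and_true, true_and, ne_eq,
      not_lt]
    constructor
    · rintro ⟨h1, h2⟩
      exact lt_of_le_of_ne h2 h1
    · intro h
      exact ⟨h.ne, h.le⟩

/-- **Symmetric pair sums.** For a symmetric kernel `a`, summing `a_{ii'} (u_i + u_i')` over the
pairs `i < i'` collects, at each index `i`, the coefficient `Σ_{i' ≠ i} a_{ii'}`. [folklore] -/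
theorem transfer_pair_sum {k : ℕ} (a : Fin k → Fin k → ℝ) (ha : ∀ i i', a i i' = a i' i)
    (u : Fin k → ℝ) :
    ∑ i, ∑ i' ∈ Finset.univ.filter (fun i' ↦ i < i'), a i i' * (u i + u i') =
      ∑ i, (∑ i' ∈ Finset.univ.erase i, a i i') * u i := by
  have hswap : ∑ i, ∑ i' ∈ Finset.univ.filter (fun i' ↦ i < i'), a i i' * u i' =
      ∑ i' : Fin k, ∑ i ∈ Finset.univ.filter (fun i ↦ i < i'), a i i' * u i' := by
    refine Finset.sum_comm' fun i i' => ?_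
    simp only [Finset.mem_univ, Finset.mem_filter, true_and, and_true]
  calc ∑ i, ∑ i' ∈ Finset.univ.filter (fun i' ↦ i < i'), a i i' * (u i + u i')
      = ∑ i, ∑ i' ∈ Finset.univ.filter (fun i' ↦ i < i'), a i i' * u i +
          ∑ i, ∑ i' ∈ Finset.univ.filter (fun i' ↦ i < i'), a i i' * u i' := by
        rw [← Finset.sum_add_distrib]
        refine Finset.sum_congr rfl fun i _ => ?_
        rw [← Finset.sum_add_distrib]
        refine Finset.sum_congr rfl fun i' _ => ?_
        ring
    _ = ∑ i, (∑ i' ∈ Finset.univ.filter (fun i' ↦ i < i'), a i i') * u i +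
          ∑ i, (∑ i' ∈ Finset.univ.filter (fun i' ↦ i' < i), a i i') * u i := by
        rw [hswap]
        congr 1
        · refine Finset.sum_congr rfl fun i _ => ?_
          rw [Finset.sum_mul]
        · refine Finset.sum_congr rfl fun i _ => ?_
          rw [Finset.sum_mul]
          refine Finset.sum_congr rfl fun i' _ => ?_
          rw [ha]
    _ = ∑ i, (∑ i' ∈ Finset.univ.erase i, a i i') * u i := by
        rw [← Finset.sum_add_distrib]
        refine Finset.sum_congr rfl fun i _ => ?_
        rw [transfer_sum_erase_split (a i) i]
        ring

/-- **The mesh powers cancel.** `Σ_i h(e_i) = 2 Σ_{i<i'} (−e_i e_i'/6)` when `Σ e = 1`. [folklore] -/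
theorem transfer_mesh {k : ℕ} (e : Fin k → ℝ) (hsum : ∑ j, e j = 1) :
    ∑ i, e i * (e i - 1) / 6 =
      2 * ∑ i, ∑ i' ∈ Finset.univ.filter (fun i' ↦ i < i'), (-(e i * e i') / 6) := by
  have h := transfer_pair_sum (fun i i' ↦ -(e i * e i') / 6) (fun i i' => by ring) (fun _ ↦ 1)
  calc ∑ i, e i * (e i - 1) / 6
      = ∑ i, (∑ i' ∈ Finset.univ.erase i, (-(e i * e i') / 6)) * 1 := by
        refine Finset.sum_congr rfl fun i _ => ?_
        rw [transfer_kac e hsum i, mul_one]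
    _ = ∑ i, ∑ i' ∈ Finset.univ.filter (fun i' ↦ i < i'), (-(e i * e i') / 6) * (1 + 1) := h.symm
    _ = 2 * ∑ i, ∑ i' ∈ Finset.univ.filter (fun i' ↦ i < i'), (-(e i * e i') / 6) := by
        rw [Finset.mul_sum]
        refine Finset.sum_congr rfl fun i _ => ?_
        rw [Finset.mul_sum]
        refine Finset.sum_congr rfl fun i' _ => ?_
        ring

/-- The crux's label vector `e_i = L_i` (sources), `e_j = 1 - L_j` (sink) sums to `1` for a
rainbow family `L_j = Σ_{i ≠ j} L_i`. [folklore] -/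
theorem transfer_sum_labels {k : ℕ} (L : Fin k → ℕ) (j : Fin k)
    (hL : L j = ∑ i ∈ Finset.univ.erase j, L i) :
    ∑ i, (if i = j then (1 - (L j : ℝ)) else (L i : ℝ)) = 1 := by
  rw [← Finset.add_sum_erase _ _ (Finset.mem_univ j), if_pos rfl,
    Finset.sum_congr rfl fun i hi => if_neg (Finset.ne_of_mem_erase hi)]
  have : (L j : ℝ) = ∑ i ∈ Finset.univ.erase j, (L i : ℝ) := by
    rw [hL]; push_cast; rfl
  rw [← this]
  ring

/-- **The limit lemma of the transfer.** If `P_n > 0` eventually,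
`log P_n − Σ_{i<i'} a_{ii'} log G_n(i,i') → ℓ`, `G_n(i,i')/δ_n² → c K_{ii'}` with `c, K_{ii'} > 0`,
and `H = 2 Σ_{i<i'} a_{ii'}`, then `δ_n^{-H} P_n → e^ℓ ∏_{i<i'} (c K_{ii'})^{a_{ii'}}`: the powers of
the mesh cancel exactly. [folklore] -/
theorem transfer_limit {k : ℕ} (P Q δ : ℕ → ℝ) (G : ℕ → Fin k → Fin k → ℝ)
    (a K : Fin k → Fin k → ℝ)
    (H c ℓ : ℝ) (hδ : ∀ n, 0 < δ n) (hc : 0 < c) (hK : ∀ i i', i < i' → 0 < K i i')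
    (hH : H = 2 * ∑ i, ∑ i' ∈ Finset.univ.filter (fun i' ↦ i < i'), a i i')
    (hP : ∀ᶠ n in Filter.atTop, 0 < P n / Q n)
    (hF : Filter.Tendsto (fun n ↦ Real.log (P n / Q n) -
      ∑ i, ∑ i' ∈ Finset.univ.filter (fun i' ↦ i < i'), a i i' * Real.log (G n i i'))
      Filter.atTop (nhds ℓ))
    (hG : ∀ i i', i < i' →
      Filter.Tendsto (fun n ↦ G n i i' / δ n ^ 2) Filter.atTop (nhds (c * K i i'))) :
    Filter.Tendsto (fun n ↦ δ n ^ (-H) * P n / Q n) Filter.atTop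
      (nhds (Real.exp ℓ *
        ∏ i, ∏ i' ∈ Finset.univ.filter (fun i' ↦ i < i'), (c * K i i') ^ (a i i'))) := by
  have hGpos : ∀ᶠ n in Filter.atTop, ∀ i i', i < i' → 0 < G n i i' := by
    simp only [Filter.eventually_all]
    intro i i' hii'
    have h := (hG i i' hii').eventually (lt_mem_nhds (mul_pos hc (hK i i' hii')))
    exact h.mono fun n hn => (div_pos_iff_of_pos_right (pow_pos (hδ n) 2)).mp hn
  have key : ∀ᶠ n in Filter.atTop, δ n ^ (-H) * P n / Q n =
      Real.exp (Real.log (P n / Q n) -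
          ∑ i, ∑ i' ∈ Finset.univ.filter (fun i' ↦ i < i'), a i i' * Real.log (G n i i')) *
        ∏ i, ∏ i' ∈ Finset.univ.filter (fun i' ↦ i < i'), (G n i i' / δ n ^ 2) ^ (a i i') := by
    filter_upwards [hP, hGpos] with n hPn hGn
    have e1 : ∀ i, ∀ i' ∈ Finset.univ.filter (fun i' ↦ i < i'),
        (G n i i' / δ n ^ 2) ^ (a i i') =
          Real.exp ((Real.log (G n i i') - 2 * Real.log (δ n)) * a i i') := by
      intro i i' hi'
      have hlt : i < i' := (Finset.mem_filter.mp hi').2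
      rw [Real.rpow_def_of_pos (div_pos (hGn i i' hlt) (pow_pos (hδ n) 2)),
        Real.log_div (hGn i i' hlt).ne' (pow_pos (hδ n) 2).ne', Real.log_pow]
      push_cast
      ring_nf
    rw [Finset.prod_congr rfl fun i _ => Finset.prod_congr rfl (e1 i), mul_div_assoc]
    simp only [← Real.exp_sum]
    rw [← Real.exp_add, Real.rpow_def_of_pos (hδ n)]
    conv_lhs => rw [← Real.exp_log hPn, ← Real.exp_add]
    congr 1
    have hs : ∑ i, ∑ i' ∈ Finset.univ.filter (fun i' ↦ i < i'),
        (Real.log (G n i i') - 2 * Real.log (δ n)) * a i i' =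
        ∑ i, ∑ i' ∈ Finset.univ.filter (fun i' ↦ i < i'), a i i' * Real.log (G n i i') -
          (2 * ∑ i, ∑ i' ∈ Finset.univ.filter (fun i' ↦ i < i'), a i i') * Real.log (δ n) := by
      rw [Finset.mul_sum, Finset.sum_mul, ← Finset.sum_sub_distrib]
      refine Finset.sum_congr rfl fun i _ => ?_
      rw [Finset.mul_sum, Finset.sum_mul, ← Finset.sum_sub_distrib]
      refine Finset.sum_congr rfl fun i' _ => ?_
      ring
    rw [hs, ← hH]
    ring
  refine (Filter.tendsto_congr' key).mpr ?_
  refine ((Real.continuous_exp.tendsto ℓ).comp hF).mul ?_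
  refine tendsto_finsetProd _ fun i _ => tendsto_finsetProd _ fun i' hi' => ?_
  have hlt : i < i' := (Finset.mem_filter.mp hi').2
  exact (hG i i' hlt).rpow_const (Or.inl (mul_pos hc (hK i i' hlt)).ne')

/-- **The limit value in the crux's shape.** With `K_{ii'} = |w′_i||w′_i'|/|w_i − w_i'|²` and
`a_{ii'} = −e_ie_i'/6`: `e^ℓ ∏_{i<i'} (c K_{ii'})^{a_{ii'}} = e^ℓ c^{Σa} ∏_{i<i'} |w_i − w_i'|^{e_ie_i'/3}
∏_i |w′_i|^{h(e_i)}` when `Σ e = 1` (by `transfer_kac`), all `w′_i ≠ 0` and the `w_i` are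
pairwise distinct. [folklore] -/
theorem transfer_limit_value {k : ℕ} (e : Fin k → ℝ) (hsum : ∑ i, e i = 1) (c ℓ : ℝ) (hc : 0 < c)
    (z d : Fin k → ℂ) (hz : ∀ i i', i ≠ i' → z i ≠ z i') (hd : ∀ i, d i ≠ 0) :
    Real.exp ℓ * ∏ i, ∏ i' ∈ Finset.univ.filter (fun i' ↦ i < i'),
        (c * (‖d i‖ * ‖d i'‖ / ‖z i - z i'‖ ^ 2)) ^ (-(e i * e i') / 6) =
      Real.exp ℓ * c ^ (∑ i, ∑ i' ∈ Finset.univ.filter (fun i' ↦ i < i'), (-(e i * e i') / 6)) *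
        (∏ i, ∏ i' ∈ Finset.univ.filter (fun i' : Fin k ↦ i < i'),
          ‖z i - z i'‖ ^ (e i * e i' / 3)) *
        ∏ i, ‖d i‖ ^ (e i * (e i - 1) / 6) := by
  have hdpos : ∀ i, 0 < ‖d i‖ := fun i => norm_pos_iff.mpr (hd i)
  have hzpos : ∀ i, ∀ i' ∈ Finset.univ.filter (fun i' ↦ i < i'), 0 < ‖z i - z i'‖ :=
    fun i i' hi' => norm_pos_iff.mpr (sub_ne_zero.mpr (hz i i' (Finset.mem_filter.mp hi').2.ne))
  have e1 : ∀ i, ∀ i' ∈ Finset.univ.filter (fun i' ↦ i < i'),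
      (c * (‖d i‖ * ‖d i'‖ / ‖z i - z i'‖ ^ 2)) ^ (-(e i * e i') / 6) =
        Real.exp ((Real.log c + Real.log ‖d i‖ + Real.log ‖d i'‖ - 2 * Real.log ‖z i - z i'‖) *
          (-(e i * e i') / 6)) := by
    intro i i' hi'
    have hzp := hzpos i i' hi'
    rw [Real.rpow_def_of_pos (mul_pos hc (div_pos (mul_pos (hdpos i) (hdpos i')) (pow_pos hzp 2))),
      Real.log_mul hc.ne' (div_pos (mul_pos (hdpos i) (hdpos i')) (pow_pos hzp 2)).ne',
      Real.log_div (mul_pos (hdpos i) (hdpos i')).ne' (pow_pos hzp 2).ne',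
      Real.log_mul (hdpos i).ne' (hdpos i').ne', Real.log_pow]
    push_cast
    ring_nf
  have e2 : ∀ i, ∀ i' ∈ Finset.univ.filter (fun i' ↦ i < i'),
      ‖z i - z i'‖ ^ (e i * e i' / 3) = Real.exp (Real.log ‖z i - z i'‖ * (e i * e i' / 3)) :=
    fun i i' hi' => Real.rpow_def_of_pos (hzpos i i' hi') _
  have e3 : ∀ i ∈ (Finset.univ : Finset (Fin k)),
      ‖d i‖ ^ (e i * (e i - 1) / 6) = Real.exp (Real.log ‖d i‖ * (e i * (e i - 1) / 6)) :=
    fun i _ => Real.rpow_def_of_pos (hdpos i) _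
  have hpair := transfer_pair_sum (fun i i' ↦ -(e i * e i') / 6) (fun i i' => by ring)
    (fun i ↦ Real.log ‖d i‖)
  have hsumid : ∑ i, ∑ i' ∈ Finset.univ.filter (fun i' ↦ i < i'),
        (Real.log c + Real.log ‖d i‖ + Real.log ‖d i'‖ - 2 * Real.log ‖z i - z i'‖) *
          (-(e i * e i') / 6)
      = Real.log c * ∑ i, ∑ i' ∈ Finset.univ.filter (fun i' ↦ i < i'), (-(e i * e i') / 6) +
        (∑ i, ∑ i' ∈ Finset.univ.filter (fun i' ↦ i < i'),
          Real.log ‖z i - z i'‖ * (e i * e i' / 3) +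
        ∑ i, Real.log ‖d i‖ * (e i * (e i - 1) / 6)) := by
    calc ∑ i, ∑ i' ∈ Finset.univ.filter (fun i' ↦ i < i'),
        (Real.log c + Real.log ‖d i‖ + Real.log ‖d i'‖ - 2 * Real.log ‖z i - z i'‖) *
          (-(e i * e i') / 6)
        = Real.log c * ∑ i, ∑ i' ∈ Finset.univ.filter (fun i' ↦ i < i'), (-(e i * e i') / 6) +
          ∑ i, ∑ i' ∈ Finset.univ.filter (fun i' ↦ i < i'),
            (-(e i * e i') / 6) * (Real.log ‖d i‖ + Real.log ‖d i'‖) +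
          ∑ i, ∑ i' ∈ Finset.univ.filter (fun i' ↦ i < i'),
            Real.log ‖z i - z i'‖ * (e i * e i' / 3) := by
          rw [Finset.mul_sum, ← Finset.sum_add_distrib, ← Finset.sum_add_distrib]
          refine Finset.sum_congr rfl fun i _ => ?_
          rw [Finset.mul_sum, ← Finset.sum_add_distrib, ← Finset.sum_add_distrib]
          refine Finset.sum_congr rfl fun i' _ => ?_
          ring
      _ = Real.log c * ∑ i, ∑ i' ∈ Finset.univ.filter (fun i' ↦ i < i'), (-(e i * e i') / 6) +
          (∑ i, ∑ i' ∈ Finset.univ.filter (fun i' ↦ i < i'),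
            Real.log ‖z i - z i'‖ * (e i * e i' / 3) +
          ∑ i, Real.log ‖d i‖ * (e i * (e i - 1) / 6)) := by
          rw [hpair]
          simp only [transfer_kac e hsum]
          rw [add_assoc, add_comm (∑ i, _ * Real.log ‖d i‖)]
          congr 2
          refine Finset.sum_congr rfl fun i _ => ?_
          ring
  rw [Finset.prod_congr rfl fun i _ => Finset.prod_congr rfl (e1 i),
    Finset.prod_congr rfl fun i _ => Finset.prod_congr rfl (e2 i), Finset.prod_congr rfl e3,
    Real.rpow_def_of_pos hc]
  simp only [← Real.exp_sum, ← Real.exp_add]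
  rw [Real.exp_eq_exp, hsumid]
  ring

/-- Finitely many points of the lattice `δℤ²` (`δ > 0`) lie in a bounded planar set. [folklore] -/
theorem transfer_lattice_finite (S : Set ℂ) (hS : Bornology.IsBounded S) (δ : ℝ) (hδ : 0 < δ) :
    {v : ℤ × ℤ | ((v.1 : ℂ) * (δ : ℂ) + (v.2 : ℂ) * (δ : ℂ) * Complex.I) ∈ S}.Finite := by
  obtain ⟨r, hr⟩ := (Metric.isBounded_iff_subset_closedBall (0 : ℂ)).1 hS
  refine ((Set.finite_Icc (-⌈r / δ⌉) ⌈r / δ⌉).prod (Set.finite_Icc (-⌈r / δ⌉) ⌈r / δ⌉)).subset ?_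
  intro v hv
  have hz := hr hv
  rw [Metric.mem_closedBall, dist_zero_right] at hz
  have hre := (Complex.abs_re_le_norm _).trans hz
  have him := (Complex.abs_im_le_norm _).trans hz
  simp only [Complex.add_re, Complex.mul_re, Complex.mul_im, Complex.I_re, Complex.I_im,
    Complex.ofReal_re, Complex.ofReal_im, Complex.intCast_re, Complex.intCast_im, Complex.add_im,
    mul_zero, sub_zero, zero_mul, add_zero, mul_one, zero_add] at hre him
  have key : ∀ a : ℤ, |(a : ℝ) * δ| ≤ r → a ∈ Set.Icc (-⌈r / δ⌉) ⌈r / δ⌉ := fun a ha => by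
    rw [abs_mul, abs_of_pos hδ, ← le_div_iff₀ hδ] at ha
    obtain ⟨h1, h2⟩ := abs_le.1 ha
    have hlo : ((-⌈r / δ⌉ : ℤ) : ℝ) ≤ a := by
      push_cast
      linarith [Int.le_ceil (r / δ)]
    have hhi : (a : ℝ) ≤ (⌈r / δ⌉ : ℤ) := h2.trans (Int.le_ceil _)
    exact ⟨by exact_mod_cast hlo, by exact_mod_cast hhi⟩
  exact ⟨key _ hre, key _ him⟩

/-- An eventual property of a shifted sequence is an eventual property of the sequence. [folklore] -/
theorem transfer_eventually_of_shift {q : ℕ → Prop} (N : ℕ) (h : ∀ᶠ n in Filter.atTop, q (n + N)) :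
    ∀ᶠ n in Filter.atTop, q n := by
  rw [Filter.eventually_atTop] at h ⊢
  obtain ⟨a, ha⟩ := h
  refine ⟨a + N, fun n hn => ?_⟩
  have h' := ha (n - N) (by omega)
  rwa [Nat.sub_add_cancel (by omega)] at h'

/-- **Registered sub-goal `s6_limitAlgebra` (Stub 6, limit algebra).** `transfer_limit` as a
closed statement: `P_n/Q_n > 0` eventually, `log(P_n/Q_n) − Σ_{i<i'} a log G_n → ℓ`,
`G_n/δ_n² → cK > 0`, `H = 2Σa` ⟹ `δ_n^{-H} P_n/Q_n → e^ℓ ∏ (cK)^a`. [folklore] -/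
theorem s6_limitAlgebra :
    ∀ (k : ℕ) (P Q δ : ℕ → ℝ) (G : ℕ → Fin k → Fin k → ℝ) (a K : Fin k → Fin k → ℝ) (H c ℓ : ℝ), (∀
    n, 0 < δ n) → 0 < c → (∀ i i', i < i' → 0 < K i i') → H = 2 * ∑ i, ∑ i' ∈ Finset.univ.filter
    (fun i' ↦ i < i'), a i i' → (∀ᶠ n in Filter.atTop, 0 < P n / Q n) → Filter.Tendsto (fun n ↦
    Real.log (P n / Q n) - ∑ i, ∑ i' ∈ Finset.univ.filter (fun i' ↦ i < i'), a i i' * Real.log (G n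
    i i')) Filter.atTop (nhds ℓ) → (∀ i i', i < i' → Filter.Tendsto (fun n ↦ G n i i' / δ n ^ 2)
    Filter.atTop (nhds (c * K i i'))) → Filter.Tendsto (fun n ↦ δ n ^ (-H) * P n / Q n) Filter.atTop
    (nhds (Real.exp ℓ * ∏ i, ∏ i' ∈ Finset.univ.filter (fun i' ↦ i < i'), (c * K i i') ^ (a i i')))
    :=
  fun _ P Q δ G a K H c ℓ hδ hc hK hH hP hF hG ↦ transfer_limit P Q δ G a K H c ℓ hδ hc hK hH hP hF hG

end Summit.CriticalPhenomena.CardyFormulaZ2.Cruxes.BoundaryDefectGaussianR.RainbowMonomialsInExcursionKernels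

end
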